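import Summits.QuantumFields.YangMills.Theorems.BalabanUVNodesN14ClassLawTVDressingTransfer
import Summits.QuantumFields.YangMills.Theorems.BalabanUVNodesN20CoreEdgeShellDial

/-!
# DAG node N14 (NE1′) → N19′ ∕ N20 ∕ N21 — ℓ¹ CLASS-MATCHING MODULO ONE CONSTANT PER LEVEL ⇐ class-law TV + NODE N14's BINDER: the one-sided ℓ¹ mismatch fractions that
# dag-n20-w3's ℓ¹-optimal shells charge to N21 (`KeyedShellWeight`), at EVERY source, from dag-n20-w4's per-set class-law TV and the whole-tilted-mean matching FILE 1
# reads from `TiltedMeanMatching`; undressed edition via FILE 2b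

Cell `pub-ymgap` (HUMAN RULING D-0062, Track A), WIDTH SEAT `pub-ymgap-dag-n14-w2` (NODE n14 = NE1′), generation 6, FILE 5; `--kind proof --supports
stmt-QuantumFields-20544 --as helper` (K3⁷; helper, NOT a discharge; count-neutral).  THEOREMS ONLY (0 `def`, 0 `instance`, 0 `sorry`).  Imports this seat's FILE 2b
`…N14ClassLawTVDressingTransfer` (through it FILE 1 `abs_tiltedMean_total_sub_total_le`, `sum_eq_mgf_finsetSum`, FILE 2a, NE1′'s `DressedMGFForm.abs_cgf_sub_sub_le`) and
dag-n20-w3's `…N20CoreEdgeShellDial` (p≈608xxx: `hybridNE7_optShell_of_l1Mismatch` — the ℓ¹-optimal shells `shA⋆ = (A − e^{−c}B)⁺`, `shB⋆ = (B − e^{c}A)⁺`) — CITED BY NAME.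

WHY.  dag-n20-w3 located the INVARIANT two-run content of K3⁷ v5 stub 2 under the free shell dial: «the class-weight vectors of the two runs match in ℓ¹ MODULO ONE CONSTANT PER
`K`, with a summable mismatch fraction» — their companion 13b feeds `KeyedShellWeight` at the reading of record from exactly the letter
  `Σ_T (A − e^{−c_K}B)⁺ ≤ w_K·Σ_T A`, `Σ_T (B − e^{c_K}A)⁺ ≤ w_K·Σ_T B`  for all `|t| ≤ l₀`, ONE constant `c_K` per level.
The constant being source-independent is where the TARGET (hence node N14) hides: a per-set class-law TV radius `ρ` at source `t` controls `Σ_T (q_t − p_t)⁺`, and the whole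
tilted-mean matching that FILE 1 reads from N14's binder pins `log(Σ_T Bf K t ∕ Σ_T A K t)` to within `l₀·r_K` of its value `c_K` at `t = 0` (`r_K = η_K + 2B·W_K + 2B·ρ_K`).  Hence
(§2 ★★ `l1Mismatch_of_binder_classLawTV`) the letter holds with `c_K = log Σ_T Bf K 0 − log Σ_T A K 0` and `w_K = ρ_K + l₀·r_K`; by FILE 2b (§3 ★★★ `l1Mismatch_dressed_of_undressed`)
from UNDRESSED letters + N14; and (§4 ★★ `hybridNE7_optShell_of_binder_classLawTV`, dag-n20-w3 BY NAME) the hybrid with the ℓ¹-optimal shells and ZERO core radius follows —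
all two-run content in N21's shell budget `w`, in which N14's `η_K` is now a visible summand.
* §1 [folklore] finite sums: `sum_posPart_sub_le_of_forall_subset` (`Σ_T (q − p)⁺ ≤ ρ`), `posPart_sub_mul_le` (`(q − λp)⁺ ≤ (q − p)⁺ + (1 − λ)⁺·p`),
  ★ `l1Mismatch_le_of_classLawTV_of_pinned` (per-set TV `ρ` + `|log Σb − log Σa − c| ≤ ε` ⇒ both one-sided fractions `≤ ρ + ε`).
* §2 ★★ at the MGF forms; §3 ★★★ undressed edition; §4 ★★ the zero-radius hybrid via dag-n20-w3.

HONEST FRAMING.  [folklore] finite sums + by-name composition on hypothesis SHAPES; `ρ`∕`ρ₀`, `W`∕`W₀`, `η` are HYPOTHESES produced by nobody (no live Stage-13 tuple exhibited, K0⁷ OPEN);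
proves NO estimate of the programme; nothing of Bałaban's asserted or instantiated; NE1′ ∕ NE7 ∕ NE7b ∕ NE7c NOT PRINTED as two-run statements for d = 4, NOT proved; N14 ∕ N19 ∕ N20 ∕ N21
NOT discharged; K3⁷ OPEN, skeleton v5 untouched; counts UNMOVED.  One finite 𝕋⁴ programme at fixed ε; R4 closes only the CONDITIONAL finite-𝕋⁴ rung `BalabanLadder.UV` — NOT ℝ⁴,
NOT OS, NOT the Yang–Mills mass gap (Clay), which is NOT proved by any of this.
-/

noncomputable section

open MeasureTheory ProbabilityTheory Finset

namespace YMDAG.N14.L1MismatchOfBinderAndClassLawTV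

open Literature.MathematicalPhysics.QuantumFieldTheory.Balaban1983to89
open Literature.MathematicalPhysics.QuantumFieldTheory.Balaban1983to89.T4MatchingAssembly (HybridNE7)
open Literature.MathematicalPhysics.QuantumFieldTheory.Balaban1983to89.T4WeightBudget (RelWeightBound)
open Summit.QuantumFields.BalabanUV.T4Continuum.NE1p.DressedMGFForm
open Summit.QuantumFields.YangMills.BalabanUVNodes.N20CoreEdgeShellDial (hybridNE7_optShell_of_l1Mismatch)
open YMDAG.N14.TargetOfBinderAndClassLawTV (abs_tiltedMean_total_sub_total_le sum_eq_mgf_finsetSum isFiniteMeasure_finsetSum)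
open YMDAG.N14.ClassLawTVDressingTransfer (classLawTV_dressed_of_undressed badWeight_dressed_of_undressed sum_dressed_pos summable_dressedRadius)

/-! ## §1 Finite sums: one-sided ℓ¹ mismatch modulo a constant from per-set TV and a pinned log-ratio of the totals -/

section FiniteSums

variable {ι : Type*} {T : Finset ι} {a b : ι → ℝ} {ρ c ε : ℝ}

/-- The positive part of the class-law difference sums to at most the per-set TV radius: `Σ_T (b∕Σb − a∕Σa)⁺ ≤ ρ` (the sum is the difference on the set where it is positive).
[folklore] -/
theorem sum_posPart_sub_le_of_forall_subset
    (hρ : ∀ S ⊆ T, |(∑ τ ∈ S, a τ) / (∑ τ ∈ T, a τ) - (∑ τ ∈ S, b τ) / (∑ τ ∈ T, b τ)| ≤ ρ) :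
    ∑ τ ∈ T, max 0 (b τ / (∑ σ ∈ T, b σ) - a τ / (∑ σ ∈ T, a σ)) ≤ ρ := by
  set d : ι → ℝ := fun τ => b τ / (∑ σ ∈ T, b σ) - a τ / (∑ σ ∈ T, a σ)
  set S := T.filter fun τ => 0 < d τ
  have hsum : ∑ τ ∈ T, max 0 (d τ) = ∑ τ ∈ S, d τ := by
    rw [← Finset.sum_filter_add_sum_filter_not T (fun τ => 0 < d τ) (fun τ => max 0 (d τ))]
    have h1 : ∑ τ ∈ T.filter (fun τ => 0 < d τ), max 0 (d τ) = ∑ τ ∈ S, d τ :=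
      Finset.sum_congr rfl fun τ hτ => max_eq_right (le_of_lt (Finset.mem_filter.mp hτ).2)
    have h2 : ∑ τ ∈ T.filter (fun τ => ¬ 0 < d τ), max 0 (d τ) = 0 :=
      Finset.sum_eq_zero fun τ hτ => max_eq_left (le_of_not_gt (Finset.mem_filter.mp hτ).2)
    rw [h1, h2, add_zero]
  rw [hsum]
  have h := hρ S (Finset.filter_subset _ _)
  rw [Finset.sum_div, Finset.sum_div, ← Finset.sum_sub_distrib] at h
  have hneg : ∑ τ ∈ S, d τ = -∑ τ ∈ S, (a τ / (∑ σ ∈ T, a σ) - b τ / (∑ σ ∈ T, b σ)) := by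
    rw [← Finset.sum_neg_distrib]; exact Finset.sum_congr rfl fun τ _ => by simp only [d]; ring
  rw [hneg]
  exact (neg_le_abs _).trans h

/-- Pointwise: `(q − λ·p)⁺ ≤ (q − p)⁺ + (1 − λ)⁺·p` for `p ≥ 0`. [folklore] -/
theorem posPart_sub_mul_le {p q lam : ℝ} (hp : 0 ≤ p) : max 0 (q - lam * p) ≤ max 0 (q - p) + max 0 (1 - lam) * p := by
  rcases le_or_gt 0 (1 - lam) with h | h
  · rw [max_eq_right h]
    rcases le_or_gt 0 (q - p) with h' | h'
    · rw [max_eq_right h']; exact max_le (by nlinarith) (by nlinarith)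
    · rw [max_eq_left h'.le]; exact max_le (by nlinarith) (by nlinarith)
  · rw [max_eq_left h.le, zero_mul, add_zero]
    exact max_le (le_max_left _ _) ((le_max_right _ _).trans' (by nlinarith))

/-- ★ **ℓ¹ CLASS-MATCHING MODULO A CONSTANT FROM PER-SET TV AND A PINNED LOG-RATIO.**  Base weights `a, b ≥ 0` with positive totals; dag-n20-w4's per-set class-law TV radius `ρ`;
a constant `c` with `|log Σb − log Σa − c| ≤ ε`.  Then both one-sided ℓ¹ mismatch fractions at `c` are `≤ ρ + ε`:
`Σ_T (b − e^{c}·a)⁺ ≤ (ρ + ε)·Σ_T b` and `Σ_T (a − e^{−c}·b)⁺ ≤ (ρ + ε)·Σ_T a` (dag-n20-w3's `hmB` ∕ `hmA` letter shapes). [folklore] -/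
theorem l1Mismatch_le_of_classLawTV_of_pinned (ha : ∀ τ ∈ T, 0 ≤ a τ) (hb : ∀ τ ∈ T, 0 ≤ b τ) (hZa : 0 < ∑ τ ∈ T, a τ) (hZb : 0 < ∑ τ ∈ T, b τ)
    (hρ : ∀ S ⊆ T, |(∑ τ ∈ S, a τ) / (∑ τ ∈ T, a τ) - (∑ τ ∈ S, b τ) / (∑ τ ∈ T, b τ)| ≤ ρ)
    (hc : |Real.log (∑ τ ∈ T, b τ) - Real.log (∑ τ ∈ T, a τ) - c| ≤ ε) :
    ∑ τ ∈ T, max 0 (b τ - Real.exp c * a τ) ≤ (ρ + ε) * ∑ τ ∈ T, b τ ∧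
      ∑ τ ∈ T, max 0 (a τ - Real.exp (-c) * b τ) ≤ (ρ + ε) * ∑ τ ∈ T, a τ := by
  -- the positive-part sums of the class-law differences are `≤ ρ` in both directions
  have hq := sum_posPart_sub_le_of_forall_subset (a := a) (b := b) hρ
  have hp : ∑ τ ∈ T, max 0 (a τ / (∑ σ ∈ T, a σ) - b τ / (∑ σ ∈ T, b σ)) ≤ ρ :=
    sum_posPart_sub_le_of_forall_subset (a := b) (b := a) fun S hS => by rw [abs_sub_comm]; exact hρ S hS
  set Za := ∑ τ ∈ T, a τ with hZa_def
  set Zb := ∑ τ ∈ T, b τ with hZb_def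
  obtain ⟨hc1, hc2⟩ := abs_le.mp hc
  have hε : 0 ≤ ε := (abs_nonneg _).trans hc
  have h1e : 1 - Real.exp (-ε) ≤ ε := by linarith [Real.add_one_le_exp (-ε)]
  have hc0 : Real.exp (Real.log Zb - Real.log Za) = Zb / Za := by rw [Real.exp_sub, Real.exp_log hZb, Real.exp_log hZa]
  -- the ratios `λ = e^{c}·Za∕Zb = e^{c − c₀}`, `λ′ = e^{−c}·Zb∕Za = e^{c₀ − c}` (`c₀ = log Zb − log Za`) are `≥ e^{−ε}`
  have hl : Real.exp (-ε) ≤ Real.exp c * Za / Zb := by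
    have : Real.exp c * Za / Zb = Real.exp (c - (Real.log Zb - Real.log Za)) := by
      rw [Real.exp_sub, hc0]; field_simp
    rw [this]; exact Real.exp_le_exp.mpr (by linarith)
  have hl' : Real.exp (-ε) ≤ Real.exp (-c) * Zb / Za := by
    have : Real.exp (-c) * Zb / Za = Real.exp ((Real.log Zb - Real.log Za) - c) := by
      rw [Real.exp_sub, hc0, Real.exp_neg]; field_simp
    rw [this]; exact Real.exp_le_exp.mpr (by linarith)
  set lam := Real.exp c * Za / Zb with hlam_def
  set lam' := Real.exp (-c) * Zb / Za with hlam'_def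
  have hlam1 : max 0 (1 - lam) ≤ ε := max_le hε (by linarith)
  have hlam1' : max 0 (1 - lam') ≤ ε := max_le hε (by linarith)
  constructor
  · -- `Σ (b − e^{c} a)⁺ = Zb · Σ (q − λ p)⁺`
    have hfac : ∀ τ ∈ T, max 0 (b τ - Real.exp c * a τ) = Zb * max 0 (b τ / Zb - lam * (a τ / Za)) := fun τ _ => by
      rw [mul_max_of_nonneg _ _ hZb.le, mul_zero]
      congr 1
      rw [hlam_def]; field_simp
    have key : ∑ τ ∈ T, max 0 (b τ / Zb - lam * (a τ / Za)) ≤ ρ + ε :=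
      calc ∑ τ ∈ T, max 0 (b τ / Zb - lam * (a τ / Za))
          ≤ ∑ τ ∈ T, (max 0 (b τ / Zb - a τ / Za) + max 0 (1 - lam) * (a τ / Za)) :=
            Finset.sum_le_sum fun τ hτ => posPart_sub_mul_le (div_nonneg (ha τ hτ) hZa.le)
        _ = (∑ τ ∈ T, max 0 (b τ / Zb - a τ / Za)) + max 0 (1 - lam) * ∑ τ ∈ T, a τ / Za := by
            rw [Finset.sum_add_distrib, Finset.mul_sum]
        _ = (∑ τ ∈ T, max 0 (b τ / Zb - a τ / Za)) + max 0 (1 - lam) := by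
            rw [← Finset.sum_div, div_self hZa.ne', mul_one]
        _ ≤ ρ + ε := add_le_add hq hlam1
    rw [Finset.sum_congr rfl hfac, ← Finset.mul_sum, mul_comm]
    exact mul_le_mul_of_nonneg_right key hZb.le
  · have hfac : ∀ τ ∈ T, max 0 (a τ - Real.exp (-c) * b τ) = Za * max 0 (a τ / Za - lam' * (b τ / Zb)) := fun τ _ => by
      rw [mul_max_of_nonneg _ _ hZa.le, mul_zero]
      congr 1
      rw [hlam'_def]; field_simp
    have key : ∑ τ ∈ T, max 0 (a τ / Za - lam' * (b τ / Zb)) ≤ ρ + ε :=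
      calc ∑ τ ∈ T, max 0 (a τ / Za - lam' * (b τ / Zb))
          ≤ ∑ τ ∈ T, (max 0 (a τ / Za - b τ / Zb) + max 0 (1 - lam') * (b τ / Zb)) :=
            Finset.sum_le_sum fun τ hτ => posPart_sub_mul_le (div_nonneg (hb τ hτ) hZb.le)
        _ = (∑ τ ∈ T, max 0 (a τ / Za - b τ / Zb)) + max 0 (1 - lam') * ∑ τ ∈ T, b τ / Zb := by
            rw [Finset.sum_add_distrib, Finset.mul_sum]
        _ = (∑ τ ∈ T, max 0 (a τ / Za - b τ / Zb)) + max 0 (1 - lam') := by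
            rw [← Finset.sum_div, div_self hZb.ne', mul_one]
        _ ≤ ρ + ε := add_le_add hp hlam1'
    rw [Finset.sum_congr rfl hfac, ← Finset.mul_sum, mul_comm]
    exact mul_le_mul_of_nonneg_right key hZa.le

end FiniteSums

/-! ## §2 At the MGF forms: the letter from N14's binder, the bad weight and the class-law TV -/

section AtForms

variable {ι : Type*} [DecidableEq ι] {Ω Ω' : ℕ → Type*} [∀ K, MeasurableSpace (Ω K)] [∀ K, MeasurableSpace (Ω' K)]
  {l₀ vol B : ℝ} {T : ℕ → Finset ι} {Bad : ℕ → ℝ → Finset ι}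
  {F : ∀ K, Ω K → ℝ} {ν : ∀ K, ι → Measure (Ω K)} {F' : ∀ K, Ω' K → ℝ} {ν' : ∀ K, ι → Measure (Ω' K)}
  {A Bf : ℕ → ℝ → ι → ℝ} {η W ρ W₀ ρ₀ : ℕ → ℝ}

/-- **THE LOG-RATIO OF THE DRESSED TOTALS IS PINNED TO ITS UNDRESSED VALUE** within `l₀·(η_K + 2B·W_K + 2B·ρ_K)` (FILE 1's whole-tilted-mean matching + NE1′'s
`abs_cgf_sub_sub_le`): `|log Σ_T Bf K t − log Σ_T A K t − (log Σ_T Bf K 0 − log Σ_T A K 0)| ≤ l₀·(η_K + 2B·W_K + 2B·ρ_K)`. [folklore] -/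
theorem abs_log_ratio_sub_log_ratio_zero_le (hA : MGFForm B T F ν A) (hB : MGFForm B T F' ν' Bf) (hη : TiltedMeanMatching l₀ T Bad F ν F' ν' η)
    (hη0 : ∀ K, 0 ≤ η K) (hBadT : ∀ (K : ℕ) (t : ℝ), |t| ≤ l₀ → Bad K t ⊆ T K)
    (hW : ∀ (K : ℕ) (t : ℝ), |t| ≤ l₀ → ∑ τ ∈ Bad K t, A K t τ ≤ W K * ∑ τ ∈ T K, A K t τ)
    (hρ : ∀ (K : ℕ) (t : ℝ), |t| ≤ l₀ → ∀ S ⊆ T K,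
      |(∑ τ ∈ S, A K t τ) / (∑ τ ∈ T K, A K t τ) - (∑ τ ∈ S, Bf K t τ) / (∑ τ ∈ T K, Bf K t τ)| ≤ ρ K)
    (hZA : ∀ (K : ℕ) (t : ℝ), |t| ≤ l₀ → 0 < ∑ τ ∈ T K, A K t τ) (hZB : ∀ (K : ℕ) (t : ℝ), |t| ≤ l₀ → 0 < ∑ τ ∈ T K, Bf K t τ)
    (K : ℕ) {t : ℝ} (ht : |t| ≤ l₀) :
    |Real.log (∑ τ ∈ T K, Bf K t τ) - Real.log (∑ τ ∈ T K, A K t τ)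
        - (Real.log (∑ τ ∈ T K, Bf K 0 τ) - Real.log (∑ τ ∈ T K, A K 0 τ))| ≤ l₀ * (η K + 2 * B * W K + 2 * B * ρ K) := by
  haveI : IsFiniteMeasure (∑ τ ∈ T K, ν K τ) := isFiniteMeasure_finsetSum (T K) (ν K) (hA.finite K)
  haveI : IsFiniteMeasure (∑ τ ∈ T K, ν' K τ) := isFiniteMeasure_finsetSum (T K) (ν' K) (hB.finite K)
  have hrate : ∀ s, |s| ≤ l₀ → |tiltedMean (F' K) (∑ τ ∈ T K, ν' K τ) s - tiltedMean (F K) (∑ τ ∈ T K, ν K τ) s|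
      ≤ η K + 2 * B * W K + 2 * B * ρ K := fun s hs => abs_tiltedMean_total_sub_total_le hA hB hη hη0 hBadT hW hρ hZA hZB K hs
  have hmv := abs_cgf_sub_sub_le (hA.meas K) (hA.bound K) (hB.meas K) (hB.bound K) hrate ht
  have h0 : |(0 : ℝ)| ≤ l₀ := by rw [abs_zero]; exact (abs_nonneg t).trans ht
  have hr0 : 0 ≤ η K + 2 * B * W K + 2 * B * ρ K := (abs_nonneg _).trans (hrate 0 h0)
  rw [sum_eq_mgf_finsetSum hB K t, sum_eq_mgf_finsetSum hA K t, sum_eq_mgf_finsetSum hB K 0, sum_eq_mgf_finsetSum hA K 0]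
  calc |Real.log (mgf (F' K) (∑ τ ∈ T K, ν' K τ) t) - Real.log (mgf (F K) (∑ τ ∈ T K, ν K τ) t)
          - (Real.log (mgf (F' K) (∑ τ ∈ T K, ν' K τ) 0) - Real.log (mgf (F K) (∑ τ ∈ T K, ν K τ) 0))|
      = |(cgf (F' K) (∑ τ ∈ T K, ν' K τ) t - cgf (F' K) (∑ τ ∈ T K, ν' K τ) 0)
          - (cgf (F K) (∑ τ ∈ T K, ν K τ) t - cgf (F K) (∑ τ ∈ T K, ν K τ) 0)| := by simp only [cgf]; ring_nf
    _ ≤ (η K + 2 * B * W K + 2 * B * ρ K) * |t| := hmv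
    _ ≤ (η K + 2 * B * W K + 2 * B * ρ K) * l₀ := mul_le_mul_of_nonneg_left ht hr0
    _ = l₀ * (η K + 2 * B * W K + 2 * B * ρ K) := mul_comm _ _

/-- ★★ **ℓ¹ CLASS-MATCHING MODULO ONE CONSTANT PER LEVEL FROM N14's BINDER, THE BAD WEIGHT AND THE CLASS-LAW TV**: at every source `|t| ≤ l₀`, with the UNDRESSED constant
`c_K = log Σ_T Bf K 0 − log Σ_T A K 0`, both one-sided ℓ¹ mismatch fractions of the DRESSED class weights are `≤ w_K := ρ_K + l₀·(η_K + 2B·W_K + 2B·ρ_K)` — dag-n20-w3's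
`hmA`∕`hmB` letter shapes (their `…CoreEdgeShellDial`), in which node N14's `η_K` is now a visible summand. [folklore] -/
theorem l1Mismatch_of_binder_classLawTV (hA : MGFForm B T F ν A) (hB : MGFForm B T F' ν' Bf) (hη : TiltedMeanMatching l₀ T Bad F ν F' ν' η)
    (hη0 : ∀ K, 0 ≤ η K) (hBadT : ∀ (K : ℕ) (t : ℝ), |t| ≤ l₀ → Bad K t ⊆ T K)
    (hW : ∀ (K : ℕ) (t : ℝ), |t| ≤ l₀ → ∑ τ ∈ Bad K t, A K t τ ≤ W K * ∑ τ ∈ T K, A K t τ)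
    (hρ : ∀ (K : ℕ) (t : ℝ), |t| ≤ l₀ → ∀ S ⊆ T K,
      |(∑ τ ∈ S, A K t τ) / (∑ τ ∈ T K, A K t τ) - (∑ τ ∈ S, Bf K t τ) / (∑ τ ∈ T K, Bf K t τ)| ≤ ρ K)
    (hZA : ∀ (K : ℕ) (t : ℝ), |t| ≤ l₀ → 0 < ∑ τ ∈ T K, A K t τ) (hZB : ∀ (K : ℕ) (t : ℝ), |t| ≤ l₀ → 0 < ∑ τ ∈ T K, Bf K t τ)
    (K : ℕ) {t : ℝ} (ht : |t| ≤ l₀) :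
    ∑ τ ∈ T K, max 0 (Bf K t τ - Real.exp (Real.log (∑ σ ∈ T K, Bf K 0 σ) - Real.log (∑ σ ∈ T K, A K 0 σ)) * A K t τ)
        ≤ (ρ K + l₀ * (η K + 2 * B * W K + 2 * B * ρ K)) * ∑ τ ∈ T K, Bf K t τ ∧
      ∑ τ ∈ T K, max 0 (A K t τ - Real.exp (-(Real.log (∑ σ ∈ T K, Bf K 0 σ) - Real.log (∑ σ ∈ T K, A K 0 σ))) * Bf K t τ)
        ≤ (ρ K + l₀ * (η K + 2 * B * W K + 2 * B * ρ K)) * ∑ τ ∈ T K, A K t τ :=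
  l1Mismatch_le_of_classLawTV_of_pinned (fun _ hτ => hA.nonneg' K t hτ) (fun _ hτ => hB.nonneg' K t hτ) (hZA K t ht) (hZB K t ht)
    (hρ K t ht) (abs_log_ratio_sub_log_ratio_zero_le hA hB hη hη0 hBadT hW hρ hZA hZB K ht)

/-! ## §3 Undressed edition (FILE 2b): the letter from UNDRESSED class-law letters and N14's binder -/

/-- ★★★ **ℓ¹ CLASS-MATCHING AT EVERY SOURCE FROM UNDRESSED LETTERS + N14**: the same two one-sided ℓ¹ mismatch fractions at the undressed constant `c_K`, now with
`w_K = ρᵈ_K + l₀·(η_K + 2B·e^{2l₀B}·W₀_K + 2B·ρᵈ_K)`, `ρᵈ_K := 2e^{2l₀B}(ρ₀_K + W₀_K) + 2(e^{l₀η_K} − 1)` the dressed radius of FILE 2b, from: the UNDRESSED per-set class-law TV `ρ₀`,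
the UNDRESSED bad weight `W₀`, N14's binder, positivity of the undressed totals. [folklore] -/
theorem l1Mismatch_dressed_of_undressed (hA : MGFForm B T F ν A) (hB : MGFForm B T F' ν' Bf) (hη : TiltedMeanMatching l₀ T Bad F ν F' ν' η)
    (hη0 : ∀ K, 0 ≤ η K) (hBadT : ∀ (K : ℕ) (t : ℝ), |t| ≤ l₀ → Bad K t ⊆ T K)
    (hW0 : ∀ (K : ℕ) (t : ℝ), |t| ≤ l₀ → ∑ τ ∈ Bad K t, A K 0 τ ≤ W₀ K * ∑ τ ∈ T K, A K 0 τ)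
    (hρ0 : ∀ (K : ℕ), ∀ S ⊆ T K,
      |(∑ τ ∈ S, A K 0 τ) / (∑ τ ∈ T K, A K 0 τ) - (∑ τ ∈ S, Bf K 0 τ) / (∑ τ ∈ T K, Bf K 0 τ)| ≤ ρ₀ K)
    (hZA0 : ∀ K, 0 < ∑ τ ∈ T K, A K 0 τ) (hZB0 : ∀ K, 0 < ∑ τ ∈ T K, Bf K 0 τ) (K : ℕ) {t : ℝ} (ht : |t| ≤ l₀) :
    ∑ τ ∈ T K, max 0 (Bf K t τ - Real.exp (Real.log (∑ σ ∈ T K, Bf K 0 σ) - Real.log (∑ σ ∈ T K, A K 0 σ)) * A K t τ)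
        ≤ ((2 * Real.exp (2 * l₀ * B) * (ρ₀ K + W₀ K) + 2 * (Real.exp (l₀ * η K) - 1))
            + l₀ * (η K + 2 * B * (Real.exp (2 * l₀ * B) * W₀ K)
              + 2 * B * (2 * Real.exp (2 * l₀ * B) * (ρ₀ K + W₀ K) + 2 * (Real.exp (l₀ * η K) - 1)))) * ∑ τ ∈ T K, Bf K t τ ∧
      ∑ τ ∈ T K, max 0 (A K t τ - Real.exp (-(Real.log (∑ σ ∈ T K, Bf K 0 σ) - Real.log (∑ σ ∈ T K, A K 0 σ))) * Bf K t τ)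
        ≤ ((2 * Real.exp (2 * l₀ * B) * (ρ₀ K + W₀ K) + 2 * (Real.exp (l₀ * η K) - 1))
            + l₀ * (η K + 2 * B * (Real.exp (2 * l₀ * B) * W₀ K)
              + 2 * B * (2 * Real.exp (2 * l₀ * B) * (ρ₀ K + W₀ K) + 2 * (Real.exp (l₀ * η K) - 1)))) * ∑ τ ∈ T K, A K t τ :=
  l1Mismatch_of_binder_classLawTV hA hB hη hη0 hBadT (fun K _ ht => badWeight_dressed_of_undressed hA hBadT hW0 hZA0 K ht)
    (fun K _ ht _ hS => classLawTV_dressed_of_undressed hA hB hη hη0 hBadT hW0 hρ0 hZA0 hZB0 K ht hS)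
    (fun K t _ => sum_dressed_pos hA hZA0 K t) (fun K t _ => sum_dressed_pos hB hZB0 K t) K ht

/-- `Σ_K (e^{l₀η_K} − 1) < ∞` for a summable nonnegative `η` (`e^x − 1 ≤ 2x` for `|x| ≤ 1`, eventually; cf. FILE 2b's `summable_dressedRadius`). [folklore] -/
theorem summable_exp_mul_sub_one (hl₀ : 0 ≤ l₀) (hηs : Summable η) (hη0 : ∀ K, 0 ≤ η K) :
    Summable fun K => Real.exp (l₀ * η K) - 1 := by
  have hsmall : ∀ᶠ K in Filter.atTop, |l₀ * η K| ≤ 1 := by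
    have h : Filter.Tendsto (fun K => l₀ * η K) Filter.atTop (nhds 0) := by
      simpa using hηs.tendsto_atTop_zero.const_mul l₀
    obtain ⟨N, hN⟩ := Metric.tendsto_atTop.mp h 1 one_pos
    exact Filter.eventually_atTop.mpr ⟨N, fun K hK => by simpa [Real.dist_eq] using (hN K hK).le⟩
  refine Summable.of_norm_bounded_eventually_nat ((hηs.mul_left l₀).mul_left 2) (hsmall.mono fun K hK => ?_)
  rw [Real.norm_eq_abs]
  calc |Real.exp (l₀ * η K) - 1| ≤ 2 * |l₀ * η K| := Real.abs_exp_sub_one_le hK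
    _ = 2 * (l₀ * η K) := by rw [abs_of_nonneg (mul_nonneg hl₀ (hη0 K))]

/-- The no-bad-class budget is summable: `Σ_K [ρᵈ_K + l₀(η_K + 2B·ρᵈ_K)] < ∞` with `ρᵈ_K = 2e^{2l₀B}ρ₀_K + 2(e^{l₀η_K} − 1)`. [folklore] -/
theorem summable_noBadBudget (hl₀ : 0 ≤ l₀) (hρ0s : Summable ρ₀) (hηs : Summable η) (hη0 : ∀ K, 0 ≤ η K) :
    Summable fun K => (2 * Real.exp (2 * l₀ * B) * ρ₀ K + 2 * (Real.exp (l₀ * η K) - 1))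
      + l₀ * (η K + 2 * B * (2 * Real.exp (2 * l₀ * B) * ρ₀ K + 2 * (Real.exp (l₀ * η K) - 1))) := by
  have hR : Summable fun K => 2 * Real.exp (2 * l₀ * B) * ρ₀ K + 2 * (Real.exp (l₀ * η K) - 1) :=
    (hρ0s.mul_left _).add ((summable_exp_mul_sub_one hl₀ hηs hη0).mul_left 2)
  exact hR.add ((hηs.add (hR.mul_left (2 * B))).mul_left l₀)

/-- ★★★ **NO-BAD-CLASS EDITION** (the shape dag-n20-w3's 13b consumes at the zero cut): N14's binder on ALL classes (`Bad = ∅`), the UNDRESSED per-set class-law TV `ρ₀`, positivity of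
the undressed totals ⇒ both one-sided ℓ¹ mismatch fractions of the DRESSED weights at the undressed constant `c_K`, for every `|t| ≤ l₀`, with the budget
`w_K = ρᵈ_K + l₀·(η_K + 2B·ρᵈ_K)`, `ρᵈ_K = 2e^{2l₀B}ρ₀_K + 2(e^{l₀η_K} − 1)` (summable by `summable_noBadBudget`). [folklore] -/
theorem l1Mismatch_dressed_of_undressed_noBad (hA : MGFForm B T F ν A) (hB : MGFForm B T F' ν' Bf)
    (hη : TiltedMeanMatching l₀ T (fun _ _ => ∅) F ν F' ν' η) (hη0 : ∀ K, 0 ≤ η K)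
    (hρ0 : ∀ (K : ℕ), ∀ S ⊆ T K,
      |(∑ τ ∈ S, A K 0 τ) / (∑ τ ∈ T K, A K 0 τ) - (∑ τ ∈ S, Bf K 0 τ) / (∑ τ ∈ T K, Bf K 0 τ)| ≤ ρ₀ K)
    (hZA0 : ∀ K, 0 < ∑ τ ∈ T K, A K 0 τ) (hZB0 : ∀ K, 0 < ∑ τ ∈ T K, Bf K 0 τ) (K : ℕ) {t : ℝ} (ht : |t| ≤ l₀) :
    ∑ τ ∈ T K, max 0 (Bf K t τ - Real.exp (Real.log (∑ σ ∈ T K, Bf K 0 σ) - Real.log (∑ σ ∈ T K, A K 0 σ)) * A K t τ)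
        ≤ ((2 * Real.exp (2 * l₀ * B) * ρ₀ K + 2 * (Real.exp (l₀ * η K) - 1))
            + l₀ * (η K + 2 * B * (2 * Real.exp (2 * l₀ * B) * ρ₀ K + 2 * (Real.exp (l₀ * η K) - 1)))) * ∑ τ ∈ T K, Bf K t τ ∧
      ∑ τ ∈ T K, max 0 (A K t τ - Real.exp (-(Real.log (∑ σ ∈ T K, Bf K 0 σ) - Real.log (∑ σ ∈ T K, A K 0 σ))) * Bf K t τ)
        ≤ ((2 * Real.exp (2 * l₀ * B) * ρ₀ K + 2 * (Real.exp (l₀ * η K) - 1))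
            + l₀ * (η K + 2 * B * (2 * Real.exp (2 * l₀ * B) * ρ₀ K + 2 * (Real.exp (l₀ * η K) - 1)))) * ∑ τ ∈ T K, A K t τ := by
  obtain ⟨h1, h2⟩ := l1Mismatch_dressed_of_undressed (Bad := fun _ _ => ∅) (W₀ := fun _ => 0) hA hB hη hη0
    (fun _ _ _ => Finset.empty_subset _) (fun K t _ => by simp) hρ0 hZA0 hZB0 K ht
  have hw : (2 * Real.exp (2 * l₀ * B) * (ρ₀ K + (fun _ : ℕ => (0 : ℝ)) K) + 2 * (Real.exp (l₀ * η K) - 1))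
        + l₀ * (η K + 2 * B * (Real.exp (2 * l₀ * B) * (fun _ : ℕ => (0 : ℝ)) K)
          + 2 * B * (2 * Real.exp (2 * l₀ * B) * (ρ₀ K + (fun _ : ℕ => (0 : ℝ)) K) + 2 * (Real.exp (l₀ * η K) - 1)))
      = (2 * Real.exp (2 * l₀ * B) * ρ₀ K + 2 * (Real.exp (l₀ * η K) - 1))
        + l₀ * (η K + 2 * B * (2 * Real.exp (2 * l₀ * B) * ρ₀ K + 2 * (Real.exp (l₀ * η K) - 1))) := by
    simp only [add_zero, mul_zero]
  rw [hw] at h1 h2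
  exact ⟨h1, h2⟩

/-! ## §4 The hybrid with the ℓ¹-optimal shells and ZERO core radius (dag-n20-w3 BY NAME): all two-run content in N21's shell budget, N14's `η` inside it -/

/-- ★★ **THE ZERO-RADIUS HYBRID FROM NE7b + CLASS-LAW TV + N14's BINDER** (dag-n20-w3's `hybridNE7_optShell_of_l1Mismatch` BY NAME on §2's letter): NE7b's `RelWeightBound l₀ T A Bf Bad W`
(its run-A half doubles as N14's bad weight), dag-n20-w4's per-set class-law TV `ρ`, N14's `TiltedMeanMatching η`, the MGF forms, positivity, `Σ ρ, Σ η < ∞` and the room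
`W_K + w_K < 1` ⇒ `HybridNE7 l₀ vol T A Bf Bad W shA⋆ shB⋆ w 0` with the ℓ¹-optimal shells at the UNDRESSED constants `c_K` and shell budget
`w_K = ρ_K + l₀(η_K + 2B·W_K + 2B·ρ_K)` — the N19′ core conjunct at radius ZERO, node N14's rate a summand of N21's budget. [folklore] -/
theorem hybridNE7_optShell_of_binder_classLawTV (hA : MGFForm B T F ν A) (hB : MGFForm B T F' ν' Bf) (hη : TiltedMeanMatching l₀ T Bad F ν F' ν' η)
    (hη0 : ∀ K, 0 ≤ η K) (hηs : Summable η) (hWb : RelWeightBound l₀ T A Bf Bad W)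
    (hρ : ∀ (K : ℕ) (t : ℝ), |t| ≤ l₀ → ∀ S ⊆ T K,
      |(∑ τ ∈ S, A K t τ) / (∑ τ ∈ T K, A K t τ) - (∑ τ ∈ S, Bf K t τ) / (∑ τ ∈ T K, Bf K t τ)| ≤ ρ K) (hρs : Summable ρ)
    (hZA : ∀ (K : ℕ) (t : ℝ), |t| ≤ l₀ → 0 < ∑ τ ∈ T K, A K t τ) (hZB : ∀ (K : ℕ) (t : ℝ), |t| ≤ l₀ → 0 < ∑ τ ∈ T K, Bf K t τ) (hl₀ : 0 ≤ l₀)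
    (hlt : ∀ K, W K + (ρ K + l₀ * (η K + 2 * B * W K + 2 * B * ρ K)) < 1) :
    HybridNE7 l₀ vol T A Bf Bad W
      (fun K t τ => max 0 (A K t τ - Real.exp (-(Real.log (∑ σ ∈ T K, Bf K 0 σ) - Real.log (∑ σ ∈ T K, A K 0 σ))) * Bf K t τ))
      (fun K t τ => max 0 (Bf K t τ - Real.exp (Real.log (∑ σ ∈ T K, Bf K 0 σ) - Real.log (∑ σ ∈ T K, A K 0 σ)) * A K t τ))
      (fun K => ρ K + l₀ * (η K + 2 * B * W K + 2 * B * ρ K)) (fun _ => 0) := by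
  have h0 : |(0 : ℝ)| ≤ l₀ := by rw [abs_zero]; exact hl₀
  have hρ0 : ∀ K, 0 ≤ ρ K := fun K => by have h := hρ K 0 h0 ∅ (Finset.empty_subset _); simpa using h
  have hw0 : ∀ K, 0 ≤ ρ K + l₀ * (η K + 2 * B * W K + 2 * B * ρ K) := fun K => by
    have := hA.nonneg; have := hWb.nonneg K; have := hη0 K; have := hρ0 K; positivity
  have hl1 := fun K t ht => l1Mismatch_of_binder_classLawTV hA hB hη hη0 hWb.bad_subset hWb.bad_left hρ hZA hZB K (t := t) ht
  exact hybridNE7_optShell_of_l1Mismatch (vol := vol) A Bf (fun K => Real.log (∑ σ ∈ T K, Bf K 0 σ) - Real.log (∑ σ ∈ T K, A K 0 σ)) hWb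
    (fun K t _ _ hτ => hA.nonneg' K t hτ) (fun K t _ _ hτ => hB.nonneg' K t hτ) hw0
    ((hρs.add (((hηs.add ((hWb.summable.mul_left (2 * B)))).add (hρs.mul_left (2 * B))).mul_left l₀)))
    (fun K t ht => (hl1 K t ht).2) (fun K t ht => (hl1 K t ht).1) hlt

end AtForms


end YMDAG.N14.L1MismatchOfBinderAndClassLawTV

end
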